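import Literature.NumberTheory.Transcendental.ComplexLinearForms
import HarnessLib

/-!
# Pointwise `(p,q)`-types of complex alternating forms (flat companion of `ComplexForms`)

The tree's type calculus (`Literature.NumberTheory.Transcendental.IsOfType`,
`Literature.Geometry.Kaehler.MForm.typeComponent`, file
`Literature/NumberTheory/Transcendental/ComplexForms.lean`) is phrased for forms
`α : MForm 𝓘(ℝ, E) M ℂ k` on a complex manifold, but it is *pointwise*: a condition on, resp. an
operation on, the single alternating map `α x : E [⋀^Fin k]→L[ℝ] ℂ`. This file extracts the
pointwise notions, for use in flat analysis on `E` (and on `ℂ^ι`):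

* `IsOfTypeAt p q η`: `p + q = k` and `η(e^{iθ}v₁,…,e^{iθ}v_k) = e^{i(p-q)θ} η(v)` (the tree's
  `HasDiagWeight (p - q)` plus the degree bookkeeping);
* `typeProjAt p q η`: the `(p,q)`-component of `η` (the tree's finite Fourier average
  `MForm.typeComponent` applied to the constant form `x ↦ η`);
* the bridges `isOfType_iff_forall_isOfTypeAt` and `typeComponent_apply`:
  `IsOfType p q α ↔ ∀ x, IsOfTypeAt p q (α x)` and `(α.typeComponent p q) x = typeProjAt p q (α x)`
  for flat forms `α : MForm 𝓘(ℝ, E) E ℂ k` (i.e. `α : E → E [⋀^Fin k]→L[ℝ] ℂ`);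
* the pointwise type calculus, transported from the tree's discharged facts
  (`isOfType_typeComponent_holds`, `IsOfType.typeComponent_eq_self`,
  `IsOfType.typeComponent_of_ne_holds`, `isOfType_zero_iff_isComplexLinearForm`): idempotence,
  orthogonality, `IsOfTypeAt ↔ typeProjAt = self`, and **`ℂ`-multilinear ⇔ type `(k,0)`**;
* `typeSubmodule p q`, the `ℂ`-submodule of forms of type `(p,q)`.

## References

* C. Voisin, *Hodge Theory and Complex Algebraic Geometry I* (2002), §2.3.1. [Voisin2002]
* D. Huybrechts, *Complex Geometry* (2005), Prop. 1.2.8. [HuybrechtsCG2005]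
-/

noncomputable section

open scoped Manifold ComplexConjugate
open Complex Function
open Literature.Geometry.Kaehler Literature.NumberTheory.Transcendental

namespace Literature.Analysis.Complex

variable {E : Type*} [NormedAddCommGroup E] [NormedSpace ℂ E] {k : ℕ}

/-! ### Pointwise type -/

/-- **Pointwise type `(p,q)`** of a complex-valued real-multilinear alternating `k`-form `η` on a
complex normed space: `p + q = k` and `η(e^{iθ}v₁, …, e^{iθ}v_k) = e^{i(p-q)θ} η(v₁, …, v_k)` for
all `θ` (Voisin (2002), §2.3.1: the weight of the `U(1)`-action). This is the value-wise content of
the tree's `IsOfType p q` (`isOfType_iff_forall_isOfTypeAt`). [cite: Voisin2002, §2.3.1] -/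
def IsOfTypeAt (p q : ℕ) (η : E [⋀^Fin k]→L[ℝ] ℂ) : Prop :=
  p + q = k ∧ ∀ (θ : ℝ) (v : Fin k → E),
    η (fun i => exp (θ * I) • v i) = exp (((p : ℤ) - q : ℤ) * θ * I) * η v

/-- A form of pointwise type `(p,q)` has degree `p + q`. [folklore] -/
theorem IsOfTypeAt.add_eq {p q : ℕ} {η : E [⋀^Fin k]→L[ℝ] ℂ} (h : IsOfTypeAt p q η) : p + q = k :=
  h.1

/-- The constant form `x ↦ η` has type `(p,q)` iff `η` has pointwise type `(p,q)`. [folklore] -/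
theorem isOfType_const_iff (p q : ℕ) (η : E [⋀^Fin k]→L[ℝ] ℂ) :
    IsOfType p q (fun _ : E => η : MForm 𝓘(ℝ, E) E ℂ k) ↔ IsOfTypeAt p q η :=
  ⟨fun h => ⟨h.1, fun θ v => h.2 0 θ v⟩, fun h => ⟨h.1, fun _ θ v => h.2 θ v⟩⟩

/-- **Bridge to the tree's `IsOfType`**: a flat form `α : E → E [⋀^Fin k]→L[ℝ] ℂ` has type
`(p,q)` iff all its values have pointwise type `(p,q)`. [folklore] -/
theorem isOfType_iff_forall_isOfTypeAt (p q : ℕ) (α : E → E [⋀^Fin k]→L[ℝ] ℂ) :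
    IsOfType p q (show MForm 𝓘(ℝ, E) E ℂ k from α) ↔ ∀ x, IsOfTypeAt p q (α x) :=
  ⟨fun h x => ⟨h.1, fun θ v => h.2 x θ v⟩, fun h => ⟨(h 0).1, fun x θ v => (h x).2 θ v⟩⟩

/-- The zero form has every pointwise type `(p,q)` with `p + q = k`. [folklore] -/
theorem isOfTypeAt_zero {p q : ℕ} (h : p + q = k) : IsOfTypeAt p q (0 : E [⋀^Fin k]→L[ℝ] ℂ) :=
  ⟨h, fun θ v => by simp⟩

/-- Pointwise type `(p,q)` is stable under addition. [folklore] -/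
theorem IsOfTypeAt.add {p q : ℕ} {η η' : E [⋀^Fin k]→L[ℝ] ℂ} (h : IsOfTypeAt p q η)
    (h' : IsOfTypeAt p q η') : IsOfTypeAt p q (η + η') :=
  ⟨h.1, fun θ v => by
    simp only [ContinuousAlternatingMap.add_apply, h.2 θ v, h'.2 θ v, mul_add]⟩

/-- Pointwise type `(p,q)` is stable under complex scalars. [folklore] -/
theorem IsOfTypeAt.smul {p q : ℕ} (c : ℂ) {η : E [⋀^Fin k]→L[ℝ] ℂ} (h : IsOfTypeAt p q η) :
    IsOfTypeAt p q (c • η) :=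
  ⟨h.1, fun θ v => by
    simp only [ContinuousAlternatingMap.smul_apply, h.2 θ v, smul_eq_mul]
    ring⟩

/-- Pointwise type `(p,q)` is stable under negation. [folklore] -/
theorem IsOfTypeAt.neg {p q : ℕ} {η : E [⋀^Fin k]→L[ℝ] ℂ} (h : IsOfTypeAt p q η) :
    IsOfTypeAt p q (-η) :=
  ⟨h.1, fun θ v => by simp only [ContinuousAlternatingMap.neg_apply, h.2 θ v, mul_neg]⟩

/-- Pointwise type `(p,q)` is stable under subtraction. [folklore] -/
theorem IsOfTypeAt.sub {p q : ℕ} {η η' : E [⋀^Fin k]→L[ℝ] ℂ} (h : IsOfTypeAt p q η)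
    (h' : IsOfTypeAt p q η') : IsOfTypeAt p q (η - η') := by
  simpa [sub_eq_add_neg] using h.add h'.neg

/-- Pointwise type `(p,q)` is stable under finite sums. [folklore] -/
theorem isOfTypeAt_sum {p q : ℕ} (h : p + q = k) {α : Type*} (s : Finset α)
    {η : α → E [⋀^Fin k]→L[ℝ] ℂ} (hη : ∀ a ∈ s, IsOfTypeAt p q (η a)) :
    IsOfTypeAt p q (∑ a ∈ s, η a) := by
  classical
  induction s using Finset.induction_on with
  | empty => simpa using isOfTypeAt_zero h
  | insert a s ha ih =>
    rw [Finset.sum_insert ha]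
    exact (hη a (Finset.mem_insert_self a s)).add (ih fun b hb => hη b (Finset.mem_insert_of_mem hb))

/-! ### The pointwise type projection -/

/-- **The pointwise `(p,q)`-component** `η^{p,q}` of an alternating `k`-form: the tree's
`MForm.typeComponent p q` (finite Fourier average over the `(2k+1)`-st roots of unity) applied to
the constant form `x ↦ η` (Voisin (2002), §2.3.1, eq. (2.4)). [cite: Voisin2002, §2.3.1 eq. (2.4)] -/
def typeProjAt (p q : ℕ) (η : E [⋀^Fin k]→L[ℝ] ℂ) : E [⋀^Fin k]→L[ℝ] ℂ :=
  (MForm.typeComponent p q (fun _ : E => η : MForm 𝓘(ℝ, E) E ℂ k) (0 : E) : _)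

/-- The tree's type component of the constant form `x ↦ η` is the constant form
`x ↦ typeProjAt p q η`. [folklore] -/
theorem typeComponent_const (p q : ℕ) (η : E [⋀^Fin k]→L[ℝ] ℂ) :
    MForm.typeComponent p q (fun _ : E => η : MForm 𝓘(ℝ, E) E ℂ k) = fun _ => typeProjAt p q η := by
  funext x
  unfold typeProjAt MForm.typeComponent MForm.weightComponent
  split_ifs <;> rfl

/-- **Bridge to the tree's `typeComponent`**: for a flat form `α`,
`(α.typeComponent p q) x = typeProjAt p q (α x)`. [folklore] -/
theorem typeComponent_apply (p q : ℕ) (α : E → E [⋀^Fin k]→L[ℝ] ℂ) (x : E) :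
    MForm.typeComponent p q (show MForm 𝓘(ℝ, E) E ℂ k from α) x = typeProjAt p q (α x) := by
  unfold typeProjAt MForm.typeComponent MForm.weightComponent
  split_ifs <;> rfl

/-- Off the antidiagonal the `(p,q)`-component vanishes. [folklore] -/
theorem typeProjAt_of_ne {p q : ℕ} (h : p + q ≠ k) (η : E [⋀^Fin k]→L[ℝ] ℂ) :
    typeProjAt p q η = 0 := by
  have := congr_fun (typeComponent_const p q η) (0 : E)
  rw [MForm.typeComponent_of_ne h] at this
  exact this.symm

/-- The type projection is additive. [folklore] -/
theorem typeProjAt_add (p q : ℕ) (η η' : E [⋀^Fin k]→L[ℝ] ℂ) :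
    typeProjAt p q (η + η') = typeProjAt p q η + typeProjAt p q η' := by
  have h := MForm.typeComponent_add p q (fun _ : E => η : MForm 𝓘(ℝ, E) E ℂ k) (fun _ => η')
  exact congr_fun h (0 : E)

/-- The type projection commutes with complex scalars. [folklore] -/
theorem typeProjAt_smul (p q : ℕ) (c : ℂ) (η : E [⋀^Fin k]→L[ℝ] ℂ) :
    typeProjAt p q (c • η) = c • typeProjAt p q η := by
  have h := MForm.typeComponent_smul p q c (fun _ : E => η : MForm 𝓘(ℝ, E) E ℂ k)
  exact congr_fun h (0 : E)

/-- `0^{p,q} = 0`. [folklore] -/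
@[simp]
theorem typeProjAt_zero (p q : ℕ) : typeProjAt p q (0 : E [⋀^Fin k]→L[ℝ] ℂ) = 0 := by
  have h := MForm.typeComponent_zero (E := E) (M := E) (k := k) p q
  exact congr_fun h (0 : E)

/-- The type projection as a `ℂ`-linear map. [folklore] -/
def typeProjₗ (p q : ℕ) : (E [⋀^Fin k]→L[ℝ] ℂ) →ₗ[ℂ] (E [⋀^Fin k]→L[ℝ] ℂ) where
  toFun := typeProjAt p q
  map_add' := typeProjAt_add p q
  map_smul' := typeProjAt_smul p q

/-- Unfolding of `typeProjₗ`. [folklore] -/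
@[simp]
theorem typeProjₗ_apply (p q : ℕ) (η : E [⋀^Fin k]→L[ℝ] ℂ) : typeProjₗ p q η = typeProjAt p q η :=
  rfl

/-! ### The pointwise type calculus (transported from the tree's discharged facts) -/

/-- The `(p,q)`-component of a `(p+q)`-form has pointwise type `(p,q)` (tree fact
`isOfType_typeComponent`, discharged). [cite: Voisin2002, §2.3.1 eq. (2.4)] -/
theorem isOfTypeAt_typeProjAt {p q : ℕ} (h : p + q = k) (η : E [⋀^Fin k]→L[ℝ] ℂ) :
    IsOfTypeAt p q (typeProjAt p q η) := by
  have ht := isOfType_typeComponent_holds (E := E) (M := E) (k := k) h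
    (fun _ : E => η : MForm 𝓘(ℝ, E) E ℂ k)
  rw [typeComponent_const] at ht
  exact (isOfType_const_iff p q _).1 ht

/-- A form of pointwise type `(p,q)` equals its `(p,q)`-component (tree:
`IsOfType.typeComponent_eq_self`). [cite: Voisin2002, §2.3.1 eq. (2.4)] -/
theorem IsOfTypeAt.typeProjAt_eq_self {p q : ℕ} {η : E [⋀^Fin k]→L[ℝ] ℂ} (h : IsOfTypeAt p q η) :
    typeProjAt p q η = η := by
  have ht := ((isOfType_const_iff p q η).2 h).typeComponent_eq_self
  rw [typeComponent_const] at ht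
  exact congr_fun ht (0 : E)

/-- The other components of a form of pure pointwise type vanish (tree:
`IsOfType.typeComponent_of_ne`, discharged). [cite: Voisin2002, §2.3.1 eq. (2.4)] -/
theorem IsOfTypeAt.typeProjAt_of_ne {p q p' q' : ℕ} {η : E [⋀^Fin k]→L[ℝ] ℂ} (h : IsOfTypeAt p q η)
    (hne : p ≠ p' ∨ q ≠ q') : typeProjAt p' q' η = 0 := by
  have ht := IsOfType.typeComponent_of_ne_holds (E := E) (M := E) (k := k)
    ((isOfType_const_iff p q η).2 h) hne
  rw [typeComponent_const] at ht
  exact congr_fun ht (0 : E)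

/-- **Characterisation of pointwise type by the projection**: for `p + q = k`,
`IsOfTypeAt p q η ↔ typeProjAt p q η = η`. [cite: Voisin2002, §2.3.1 eq. (2.4)] -/
theorem isOfTypeAt_iff_typeProjAt_eq_self {p q : ℕ} (h : p + q = k) (η : E [⋀^Fin k]→L[ℝ] ℂ) :
    IsOfTypeAt p q η ↔ typeProjAt p q η = η :=
  ⟨fun hη => hη.typeProjAt_eq_self, fun hη => hη ▸ isOfTypeAt_typeProjAt h η⟩

/-- Idempotence of the pointwise type projection. [cite: Voisin2002, §2.3.1 eq. (2.4)] -/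
theorem typeProjAt_typeProjAt_self (p q : ℕ) (η : E [⋀^Fin k]→L[ℝ] ℂ) :
    typeProjAt p q (typeProjAt p q η) = typeProjAt p q η := by
  by_cases h : p + q = k
  · exact (isOfTypeAt_typeProjAt h η).typeProjAt_eq_self
  · rw [typeProjAt_of_ne h, typeProjAt_of_ne h]

/-- Forms of two different pointwise types are zero. [folklore] -/
theorem IsOfTypeAt.eq_zero_of_isOfTypeAt_of_ne {p q p' q' : ℕ} {η : E [⋀^Fin k]→L[ℝ] ℂ}
    (h : IsOfTypeAt p q η) (h' : IsOfTypeAt p' q' η) (hne : p ≠ p' ∨ q ≠ q') : η = 0 := by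
  rw [← h'.typeProjAt_eq_self]
  exact h.typeProjAt_of_ne hne

/-! ### `ℂ`-multilinear forms are the forms of type `(k,0)` -/

/-- The constant form `x ↦ η` is `ℂ`-multilinear in the tree's sense iff `η` is `ℂ`-linear in
each slot. [folklore] -/
theorem isComplexLinearForm_const_iff (η : E [⋀^Fin k]→L[ℝ] ℂ) :
    IsComplexLinearForm (fun _ : E => η : MForm 𝓘(ℝ, E) E ℂ k) ↔
      ∀ (v : Fin k → E) (j : Fin k) (c : ℂ), η (update v j (c • v j)) = c * η v :=
  ⟨fun h v j c => h 0 v j c, fun h _ v j c => h v j c⟩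

/-- **A form `ℂ`-linear in each slot has pointwise type `(k,0)`** (Huybrechts, Prop. 1.2.8; tree:
`IsComplexLinearForm.isOfType`). [cite: HuybrechtsCG2005, Prop. 1.2.8] -/
theorem isOfTypeAt_of_forall_update_smul {η : E [⋀^Fin k]→L[ℝ] ℂ}
    (h : ∀ (v : Fin k → E) (j : Fin k) (c : ℂ), η (update v j (c • v j)) = c * η v) :
    IsOfTypeAt k 0 η :=
  (isOfType_const_iff k 0 η).1 ((isComplexLinearForm_const_iff η).2 h).isOfType

/-- **A form of pointwise type `(k,0)` is `ℂ`-linear in each slot** (Huybrechts, Prop. 1.2.8;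
tree: `IsOfType.isComplexLinearForm`). [cite: HuybrechtsCG2005, Prop. 1.2.8] -/
theorem IsOfTypeAt.map_update_smul {η : E [⋀^Fin k]→L[ℝ] ℂ} (h : IsOfTypeAt k 0 η)
    (v : Fin k → E) (j : Fin k) (c : ℂ) : η (update v j (c • v j)) = c * η v :=
  (isComplexLinearForm_const_iff η).1 ((isOfType_const_iff k 0 η).2 h).isComplexLinearForm v j c

/-! ### The submodule of forms of type `(p,q)` -/

variable (E k) in
/-- The `ℂ`-submodule `Λ^{p,q} ⊆ Λ^k` of alternating `k`-forms of pointwise type `(p,q)` (the zero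
submodule when `p + q ≠ k`). [cite: Voisin2002, §2.3.1] -/
def typeSubmodule (p q : ℕ) : Submodule ℂ (E [⋀^Fin k]→L[ℝ] ℂ) where
  carrier := {η | typeProjAt p q η = η}
  add_mem' {η η'} hη hη' := by
    simp only [Set.mem_setOf_eq] at hη hη' ⊢
    rw [typeProjAt_add, hη, hη']
  zero_mem' := by simp
  smul_mem' c η hη := by
    simp only [Set.mem_setOf_eq] at hη ⊢
    rw [typeProjAt_smul, hη]

/-- Membership in `Λ^{p,q}` is `typeProjAt p q η = η`. [folklore] -/
theorem mem_typeSubmodule_iff {p q : ℕ} {η : E [⋀^Fin k]→L[ℝ] ℂ} :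
    η ∈ typeSubmodule E k p q ↔ typeProjAt p q η = η :=
  Iff.rfl

/-- For `p + q = k`, membership in `Λ^{p,q}` is pointwise type `(p,q)`. [folklore] -/
theorem mem_typeSubmodule_iff_isOfTypeAt {p q : ℕ} (h : p + q = k) {η : E [⋀^Fin k]→L[ℝ] ℂ} :
    η ∈ typeSubmodule E k p q ↔ IsOfTypeAt p q η := by
  rw [mem_typeSubmodule_iff, isOfTypeAt_iff_typeProjAt_eq_self h]

/-- A form of pointwise type `(p,q)` lies in `Λ^{p,q}`. [folklore] -/
theorem IsOfTypeAt.mem_typeSubmodule {p q : ℕ} {η : E [⋀^Fin k]→L[ℝ] ℂ} (h : IsOfTypeAt p q η) :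
    η ∈ typeSubmodule E k p q :=
  (mem_typeSubmodule_iff_isOfTypeAt h.1).2 h

/-- Elements of `Λ^{p,q}` have pointwise type `(p,q)` once `p + q = k`. [folklore] -/
theorem isOfTypeAt_of_mem_typeSubmodule {p q : ℕ} (h : p + q = k) {η : E [⋀^Fin k]→L[ℝ] ℂ}
    (hη : η ∈ typeSubmodule E k p q) : IsOfTypeAt p q η :=
  (mem_typeSubmodule_iff_isOfTypeAt h).1 hη

/-! ### The type projection as a continuous linear operator -/

/-- Rotation `v ↦ e^{iθ} v` of the complex normed space `E`, as a real continuous linear map (the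
tree's `tangentRotate E x θ` on the flat manifold `M = E`). [cite: Voisin2002, §2.3.1] -/
def rotateCLM (θ : ℝ) : E →L[ℝ] E :=
  ((exp (θ * I) • ContinuousLinearMap.id ℂ E).restrictScalars ℝ : E →L[ℝ] E)

/-- `rotateCLM θ v = e^{iθ} • v`. [folklore] -/
@[simp]
theorem rotateCLM_apply (θ : ℝ) (v : E) : rotateCLM θ v = exp (θ * I) • v := rfl

/-- The explicit finite-Fourier formula for `typeProjAt` (the tree's `MForm.weightComponent`
unfolded on the constant form, with `tangentRotate E 0 θ = rotateCLM θ`). [cite: Voisin2002, §2.3.1 eq. (2.4)] -/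
theorem typeProjAt_eq (p q : ℕ) (η : E [⋀^Fin k]→L[ℝ] ℂ) :
    typeProjAt p q η = if p + q = k then ((2 * k + 1 : ℕ) : ℂ)⁻¹ • ∑ j : Fin (2 * k + 1),
      exp (-(((p : ℤ) - q : ℤ) * (2 * Real.pi * j / (2 * k + 1)) : ℝ) * I) •
        η.compContinuousLinearMap (rotateCLM (2 * Real.pi * j / (2 * k + 1))) else 0 := by
  unfold typeProjAt MForm.typeComponent MForm.weightComponent rotateCLM tangentRotate
  split_ifs <;> rfl

/-- The type projection is continuous (an explicit finite sum of precompositions with the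
rotations `e^{iθ_j}`). [folklore] -/
theorem continuous_typeProjAt (p q : ℕ) : Continuous (typeProjAt (E := E) (k := k) p q) := by
  rw [show typeProjAt (E := E) (k := k) p q = _ from funext (typeProjAt_eq p q)]
  split_ifs
  · apply Continuous.fun_const_smul
    refine continuous_finsetSum _ fun j _ => ?_
    apply Continuous.fun_const_smul
    exact (ContinuousAlternatingMap.compContinuousLinearMapCLM
      (rotateCLM (E := E) (2 * Real.pi * j / (2 * k + 1))) :
        (E [⋀^Fin k]→L[ℝ] ℂ) →L[ℝ] (E [⋀^Fin k]→L[ℝ] ℂ)).continuous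
  · exact continuous_const

/-- **The type projection as a continuous `ℂ`-linear operator** `Λ^k → Λ^k`. [folklore] -/
def typeProjL (p q : ℕ) : (E [⋀^Fin k]→L[ℝ] ℂ) →L[ℂ] (E [⋀^Fin k]→L[ℝ] ℂ) :=
  { typeProjₗ p q with cont := continuous_typeProjAt p q }

/-- Unfolding of `typeProjL`. [folklore] -/
@[simp]
theorem typeProjL_apply (p q : ℕ) (η : E [⋀^Fin k]→L[ℝ] ℂ) : typeProjL p q η = typeProjAt p q η :=
  rfl

/-- `Λ^{p,q}` is the fixed-point set of the continuous `typeProjL p q`, hence closed. [folklore] -/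
theorem isClosed_typeSubmodule (p q : ℕ) :
    IsClosed (typeSubmodule E k p q : Set (E [⋀^Fin k]→L[ℝ] ℂ)) :=
  isClosed_eq (continuous_typeProjAt p q) continuous_id

/-- `Λ^{p,q}` is complete. [folklore] -/
instance completeSpace_typeSubmodule (p q : ℕ) : CompleteSpace (typeSubmodule E k p q) :=
  (isClosed_typeSubmodule p q).completeSpace_coe

end Literature.Analysis.Complex
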